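import Mathlib
import HarnessLib
import Summits.NavierStokesRegularity.NavierStokesRegularity.Theorems.TaylorModelRungThreeReadoutFlowPackageV

/-!
# Line `taylor-model` on crux K1b-DR (stmt-NavierStokesRegularity-23954) — (E) supplement: the IN-STEP mean-value
# transport of the v3 package (every `u ∈ [0,h]`, columns by the variational Taylor model)

`IsFlowPackageV`'s (F8′) gives the mean-value matrix at the END of a sub-step inside the emitted enclosure
`[Mlo, Mhi]`.  The radii/read-out bookkeeping (`ChainVRadii`, PROPAGATE-V-SPEC-cert1 §2 G: in-step spreads, M-clause,
section read-outs at the crossing, level-wise in-step tubes) also needs the transport at intermediate times `u`, where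
no enclosure is emitted.  This file supplies it in POINT form from the landed pieces: for `z, z'` in the outer start hull
and `u ∈ [0,h]` there is a real matrix `A` with `φ(z,u) − φ(z',u) = A·(z − z')` (window components) whose every entry
is, row by row, an entry of the flow derivative at a hull point, hence lies in `ω_c⁻¹·[loV,hiV]` and within
`JU·ω_c⁻¹·u^(pdegV+1)` of the variational Taylor polynomial `Σ_{n≤pdegV} varJet (Qw cd) ζ e_c n · u^n` at SOME hull
point `ζ` (which the checker bounds by interval jets over the hull — typer's `wColLevelsA`).

* `inStep_meanValue_of_core` — the statement above, from `ChainVCore` (+ `StageNumerics` data).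

MODEL-lattice rung TL-M3 only; nothing here is a statement about the Navier–Stokes equations.
-/

noncomputable section

-- the sub-problem namespace repeats the summit name by design (D-0017)
set_option linter.dupNamespace false

namespace Summit.NavierStokesRegularity.NavierStokesRegularity.Theorems.TaylorModelV

open Set Finset
open Literature.Analysis.FluidPDE.TaoCascade Literature.Analysis.FluidPDE.TaoCascade.TaylorChain
open Summit.NavierStokesRegularity.NavierStokesRegularity.Theorems.TaylorModelMajorant
open Summit.NavierStokesRegularity.NavierStokesRegularity.Theorems.TaylorModelVector
open Summit.NavierStokesRegularity.NavierStokesRegularity.Theorems.TaylorModelReadout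

variable {cd : CertData} {bx : StepBoxes}

/-- **IN-STEP MEAN-VALUE TRANSPORT** of the selector flow: see the module docstring. [folklore] -/
theorem inStep_meanValue_of_core (hSN : cd.StageNumerics) (hC : ChainVCore cd bx) {j : ℕ} (hj : j ≤ cd.N₀)
    {s' : ℕ} (hs' : s' < cd.S j) {z z' : Fin 4 → ℤ → ℝ}
    (hz : InBox cd (bx.hlo 2 j s') (bx.hhi 2 j s') z) (hz' : InBox cd (bx.hlo 2 j s') (bx.hhi 2 j s') z')
    {u : ℝ} (hu : u ∈ Icc 0 (cd.h j s')) :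
    ∃ A : Fin (nW cd) → Fin (nW cd) → ℝ,
      (∀ c c', A c' c ∈ Icc ((wW cd j c)⁻¹ * toVec cd (bx.loV j s') c') ((wW cd j c)⁻¹ * toVec cd (bx.hiV j s') c') ∧
        ∃ ζ ∈ Icc (toVec cd (bx.hlo 2 j s')) (toVec cd (bx.hhi 2 j s')),
          |A c' c - ∑ n ∈ Finset.range (bx.pdegV + 1), varJet (Qw cd) ζ (Pi.single c 1) n c' * u ^ n| ≤
            toVec cd (bx.JU j s') c' * (wW cd j c)⁻¹ * u ^ (bx.pdegV + 1)) ∧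
      ∀ i' k' (hk₁ : -cd.Kb ≤ k') (hk₂ : k' ≤ cd.Ka),
        (stAt (fun _ => liftFlow cd (fun x s => flowSel (Qw cd) x s)) j z u -
          stAt (fun _ => liftFlow cd (fun x s => flowSel (Qw cd) x s)) j z' u) i' k' =
          ∑ c : Fin (nW cd), A (eW cd (i', ⟨k', Finset.mem_Icc.2 ⟨hk₁, hk₂⟩⟩)) c * toVec cd (z - z') c := by
  -- stage data and the sub-step clauses
  have hω : ∀ k, 0 < cd.ω j k := (hSN.1 j hj).2.2.2.2.2.2.1
  have hMS := majorantQw (cd := cd) hω (hSN.2 j hj).1 (hSN.2 j hj).2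
  obtain ⟨-, -, -, hstep⟩ := hC j hj
  obtain ⟨hh, -, hE, hJ, hK0, -, -, hVincl, hVtest, -, hJU, -⟩ := hstep s' hs'
  have hh' : 0 ≤ cd.h j s' := hh.le
  have hK00 : ∀ i k, -cd.Kb ≤ k → k ≤ cd.Ka → bx.loK j s' i k ≤ 0 ∧ 0 ≤ bx.hiK j s' i k :=
    fun i k hk1 hk2 => ⟨(hK0 i k hk1 hk2).1, (hK0 i k hk1 hk2).2.1⟩
  have hJB : ∀ y : Fin 4 → ℤ → ℝ, (∀ i k, -cd.Kb ≤ k → k ≤ cd.Ka → bx.lo j s' i k ≤ y i k ∧ y i k ≤ bx.hi j s' i k) →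
      ∀ i k, -cd.Kb ≤ k → k ≤ cd.Ka → |taylorJet cd.Qb y (cd.pdeg + 1) i k| ≤ bx.J j s' i k :=
    fun y hy => hJ y (inTube_of_inBox hK00 hy)
  have hVtestB : ∀ v₀ : Fin 4 → ℤ → ℝ, cd.InBall j v₀ 1 → ∀ y v : Fin 4 → ℤ → ℝ,
      (∀ i k, -cd.Kb ≤ k → k ≤ cd.Ka → bx.lo j s' i k ≤ y i k ∧ y i k ≤ bx.hi j s' i k) →
      (∀ i k, -cd.Kb ≤ k → k ≤ cd.Ka → bx.loV j s' i k ≤ v i k ∧ v i k ≤ bx.hiV j s' i k) → ∀ u ∈ Icc (0:ℝ) (cd.h j s'),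
        ∀ i k, -cd.Kb ≤ k → k ≤ cd.Ka →
          bx.loV j s' i k ≤ (v₀ + u • (cd.Qb y v + cd.Qb v y)) i k ∧
          (v₀ + u • (cd.Qb y v + cd.Qb v y)) i k ≤ bx.hiV j s' i k :=
    fun v₀ hv₀ y v hy hv u hu => hVtest v₀ hv₀ y v (inTube2_of_inTube hK00 (inTube_of_inBox hK00 hy)) hv u hu
  have hJUB : ∀ y v : Fin 4 → ℤ → ℝ, (∀ i k, -cd.Kb ≤ k → k ≤ cd.Ka → bx.lo j s' i k ≤ y i k ∧ y i k ≤ bx.hi j s' i k) →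
      (∀ i k, -cd.Kb ≤ k → k ≤ cd.Ka → bx.loV j s' i k ≤ v i k ∧ v i k ≤ bx.hiV j s' i k) →
      ∀ i k, -cd.Kb ≤ k → k ≤ cd.Ka → |varJet cd.Qb y v (bx.pdegV + 1) i k| ≤ bx.JU j s' i k :=
    fun y v hy hv => hJU y v (inTube2_of_inTube hK00 (inTube_of_inBox hK00 hy)) hv
  -- every hull start solves on `[0,h]` inside the state box (both test branches), window form
  have hsolW : ∀ yv ∈ Icc (toVec cd (bx.hlo 2 j s')) (toVec cd (bx.hhi 2 j s')),
      IsSolOn (Qw cd) yv (cd.h j s') (fun s => flowSel (Qw cd) yv s) ∧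
        ∀ u ∈ Icc 0 (cd.h j s'), flowSel (Qw cd) yv u ∈ Icc (toVec cd (bx.lo j s')) (toVec cd (bx.hi j s')) := by
    intro yv hyv
    have hzof := ofVec_window_bounds (cd := cd) hyv
    rcases hE with hE1 | hE2
    · obtain ⟨hx, henc⟩ := hE1 _ hzof
      have h1 := flowSel_isSolOn_mem_Icc hMS (toVec_mem_Icc_of_bounds (cd := cd) hx) hh' (roughEnclosure_toVec henc)
      rw [toVec_ofVec] at h1
      exact h1
    · have h1 := flowSel_window_of_hoTest hMS hh' hJB (hE2 _ hzof)
      rw [toVec_ofVec] at h1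
      exact ⟨h1.1, h1.2.1⟩
  -- the derivative family at time `u` on the hull box, with column facts
  have hder : ∀ yv ∈ Icc (toVec cd (bx.hlo 2 j s')) (toVec cd (bx.hhi 2 j s')),
      ∃ L : (Fin (nW cd) → ℝ) →L[ℝ] (Fin (nW cd) → ℝ),
        HasFDerivWithinAt (fun yv => flowSel (Qw cd) yv u) L
          (Icc (toVec cd (bx.hlo 2 j s')) (toVec cd (bx.hhi 2 j s'))) yv ∧
        (∀ c, L (Pi.single c 1) ∈ Icc ((wW cd j c)⁻¹ • toVec cd (bx.loV j s')) ((wW cd j c)⁻¹ • toVec cd (bx.hiV j s'))) ∧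
        ∀ c c', |L (Pi.single c 1) c' -
            ∑ n ∈ Finset.range (bx.pdegV + 1), varJet (Qw cd) yv (Pi.single c 1) n c' * u ^ n| ≤
          toVec cd (bx.JU j s') c' * (wW cd j c)⁻¹ * u ^ (bx.pdegV + 1) :=
    fun yv hyv => varTaylor_fderiv_flowSel_of_tests hMS hω hh' hsolW hVincl hVtestB hJUB hyv hu
  classical
  set f' : (Fin (nW cd) → ℝ) → (Fin (nW cd) → ℝ) →L[ℝ] (Fin (nW cd) → ℝ) := fun yv =>
    if hyv : yv ∈ Icc (toVec cd (bx.hlo 2 j s')) (toVec cd (bx.hhi 2 j s')) then Classical.choose (hder yv hyv) else 0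
    with hf'
  have hf'spec : ∀ yv (hyv : yv ∈ Icc (toVec cd (bx.hlo 2 j s')) (toVec cd (bx.hhi 2 j s'))),
      HasFDerivWithinAt (fun yv => flowSel (Qw cd) yv u) (f' yv)
          (Icc (toVec cd (bx.hlo 2 j s')) (toVec cd (bx.hhi 2 j s'))) yv ∧
        (∀ c, f' yv (Pi.single c 1) ∈ Icc ((wW cd j c)⁻¹ • toVec cd (bx.loV j s')) ((wW cd j c)⁻¹ • toVec cd (bx.hiV j s'))) ∧
        ∀ c c', |f' yv (Pi.single c 1) c' -
            ∑ n ∈ Finset.range (bx.pdegV + 1), varJet (Qw cd) yv (Pi.single c 1) n c' * u ^ n| ≤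
          toVec cd (bx.JU j s') c' * (wW cd j c)⁻¹ * u ^ (bx.pdegV + 1) := by
    intro yv hyv
    have h1 := Classical.choose_spec (hder yv hyv)
    simp only [hf', dif_pos hyv]
    exact h1
  obtain ⟨ξ, hξ, hξeq⟩ := exists_rowPoints_of_hasFDerivWithin (convex_Icc _ _) (fun yv hyv => (hf'spec yv hyv).1)
    (toVec_mem_Icc_of_bounds (cd := cd) hz) (toVec_mem_Icc_of_bounds (cd := cd) hz')
  refine ⟨fun c' c => f' (ξ c') (Pi.single c 1) c', fun c c' => ⟨?_, ξ c', (hξ c').1, (hf'spec _ (hξ c').1).2.2 c c'⟩, ?_⟩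
  · have h1 := (hf'spec _ (hξ c').1).2.1 c
    exact ⟨by simpa using h1.1 c', by simpa using h1.2 c'⟩
  · intro i' k' hk1' hk2'
    have hk' : -cd.Kb ≤ k' ∧ k' ≤ cd.Ka := ⟨hk1', hk2'⟩
    rw [stAt_liftFlow, stAt_liftFlow, ← ofVec_sub, ofVec_apply_of_mem cd _ i' hk']
    have h1 := hξeq (eW cd (i', ⟨k', Finset.mem_Icc.2 hk'⟩))
    rw [Pi.sub_apply] at h1
    rw [toVec_sub]
    exact h1

end Summit.NavierStokesRegularity.NavierStokesRegularity.Theorems.TaylorModelV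

end
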